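import Summits.Ventures.HSemireg.WedgeHankelRecurrenceGaussChebyshevFejerKernel

/-!
# Venture HSemireg — **TRUNCATED GENERATING FUNCTIONS IN EVERY COMMUTATIVE RING: `(1 − xt + t²)·Σ_{k≤n} S_k(x)t^k = 1 − S_{n+1}(x)t^{n+1} + S_n(x)t^{n+2}`,
# `(1 − xt + t²)·Σ_{k≤n} C_k(x)t^k = 2 − xt − C_{n+1}(x)t^{n+1} + C_n(x)t^{n+2}`, `(1 − 2xt + t²)·Σ_{k≤n} U_k(x)t^k = 1 − U_{n+1}(x)t^{n+1} + U_n(x)t^{n+2}`,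
# `(1 − 2xt + t²)·Σ_{k≤n} T_k(x)t^k = 1 − xt − T_{n+1}(x)t^{n+1} + T_n(x)t^{n+2}`** (the finite forms of `Σ S_k t^k = 1∕(1 − xt + t²)`, `Σ C_k t^k = (2 − xt)∕(1 − xt + t²)`,
# `Σ U_k t^k = 1∕(1 − 2xt + t²)`, `Σ T_k t^k = (1 − xt)∕(1 − 2xt + t²)`, valid for all `x, t` in any commutative ring — no convergence, no division)

HONEST FRAMING. Part of the Lean index of the computation cell `pub-hsemireg` (seat p10 gen 49, Sunday typer «UNIFORM-IN-n»).  Polynomial algebra over a commutative ring (Mathlib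
`Polynomial.Chebyshev.T ∕ U ∕ C ∕ S`, `Finset.sum`); no variety, no cohomology theory, no sheaf, no Ext group and no semiregularity map is constructed here; nothing here says that HC / HC_CM / HC_AV
holds; no Literature fact (unproved `Prop`) is declared or used.  Custodian versions as in `WedgeHankelSiegelIdeal` (1/3).
SOURCES (cited).  T. J. Rivlin, *The Chebyshev Polynomials* (Wiley 1974), §1.5 (generating functions (1.104)–(1.105)); J. C. Mason, D. C. Handscomb, *Chebyshev Polynomials* (2003), §1.4.2; NIST DLMF
§18.12 (18.12.8–18.12.10); A. F. Horadam, *Vieta polynomials*, Fibonacci Quart. 40 (2002) 223–232 (the `S ∕ C` normalisation).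
PROOF TYPED HERE.  Induction on `n`: adding the term `P_{n+1}t^{n+1}` changes the right-hand side by `(1 − xt + t²)P_{n+1}t^{n+1}`, and `P_{n+2} = xP_{n+1} − P_n` (resp. `2x` for `T ∕ U`; Mathlib
`S_add_two ∕ C_add_two ∕ U_add_two ∕ T_add_two` evaluated at `x`) closes the step by `linear_combination`; the bases are `S_0 = 1, S_1 = x`, `C_0 = 2, C_1 = x`, `U_0 = 1, U_1 = 2x`, `T_0 = 1, T_1 = x`.
DEDUP DISCLOSURE (`rg -n -i 'generating function|PowerSeries|genFun' Summits/Ventures/HSemireg Literature/Algebra/Polynomial -g '*.lean'`, 2026-09-04): the FORMAL power-series identities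
`(Σ_n P_n uⁿ)·(1 − (2)Xu + u²) = …` in `R[X]⟦u⟧` ARE in the tree — `Literature.Algebra.Polynomial.ChebyshevCoefficientFormulas` (`chebyshevT_genFun`, `chebyshevU_genFun`, `chebyshevC_genFun`,
`chebyshevS_genFun`, Rivlin (1.105)–(1.107), and the analytic `hasSum_chebyshevT_eval_mul_pow`); that module does `import Mathlib` and is CITED, not imported into this chain.  The chapter's Bezoutian
leaves mention generating functions of Bezoutians only.  The TRUNCATED (finite-sum, division-free) identities below are not typed anywhere; 0 hits for the 4 names below.

WHAT IS IN THE TREE.  `Literature.Algebra.Polynomial.ChebyshevCoefficientFormulas.chebyshev{T,U,C,S}_genFun` (formal versions, cited); Mathlib `S_zero ∕ S_one ∕ S_add_two`, `C_zero ∕ C_one ∕ C_add_two`,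
`U_zero ∕ U_one ∕ U_add_two`, `T_zero ∕ T_one ∕ T_add_two`, `Finset.sum_range_succ`.
THIS FILE (namespace `Summit.Ventures.HSemireg.Wedge.HankelOuter` continued; CHAINED on N539; 0 definitions):
* §1305 **`chebyshevS_genFun_trunc`**, **`chebyshevC_genFun_trunc`**, **`chebyshevU_genFun_trunc`**, **`chebyshevT_genFun_trunc`** (statements as in the title, `x t : A`, `A` any commutative ring, `n ∈ ℕ`).
CAVEATS.  Truncated (polynomial) identities only; for the formal power-series versions see the Literature module above and N541.  Nothing Ext-side.  New names only.
-/

open Module Polynomial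
open scoped Matrix Polynomial

namespace Summit.Ventures.HSemireg.Wedge.HankelOuter

/-! ## §1305. Truncated generating functions -/

/-- **`(1 − xt + t²)·Σ_{k≤n} S_k(x)t^k = 1 − S_{n+1}(x)t^{n+1} + S_n(x)t^{n+2}`** (`x, t` in any commutative ring). [Rivlin 1974, §1.5; Horadam 2002; this file, §1305] -/
theorem chebyshevS_genFun_trunc {A : Type*} [CommRing A] (x t : A) (n : ℕ) :
    (1 - x * t + t ^ 2) * ∑ k ∈ Finset.range (n + 1), (Polynomial.Chebyshev.S A (k : ℤ)).eval x * t ^ k =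
      1 - (Polynomial.Chebyshev.S A ((n : ℤ) + 1)).eval x * t ^ (n + 1) + (Polynomial.Chebyshev.S A (n : ℤ)).eval x * t ^ (n + 2) := by
  induction n with
  | zero =>
    simp only [zero_add, Finset.sum_range_one, Nat.cast_zero, Polynomial.Chebyshev.S_zero, eval_one, pow_zero, Polynomial.Chebyshev.S_one, eval_X]
    ring
  | succ m ih =>
    rw [Finset.sum_range_succ, mul_add, ih]
    have h := congrArg (Polynomial.eval x) (Polynomial.Chebyshev.S_add_two A (m : ℤ))
    simp only [eval_sub, eval_mul, eval_X] at h
    push_cast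
    rw [show (m : ℤ) + 1 + 1 = (m : ℤ) + 2 by ring, h]
    ring

/-- **`(1 − xt + t²)·Σ_{k≤n} C_k(x)t^k = 2 − xt − C_{n+1}(x)t^{n+1} + C_n(x)t^{n+2}`** (`x, t` in any commutative ring). [Rivlin 1974, §1.5; Horadam 2002; this file, §1305] -/
theorem chebyshevC_genFun_trunc {A : Type*} [CommRing A] (x t : A) (n : ℕ) :
    (1 - x * t + t ^ 2) * ∑ k ∈ Finset.range (n + 1), (Polynomial.Chebyshev.C A (k : ℤ)).eval x * t ^ k =
      2 - x * t - (Polynomial.Chebyshev.C A ((n : ℤ) + 1)).eval x * t ^ (n + 1) + (Polynomial.Chebyshev.C A (n : ℤ)).eval x * t ^ (n + 2) := by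
  induction n with
  | zero =>
    simp only [zero_add, Finset.sum_range_one, Nat.cast_zero, Polynomial.Chebyshev.C_zero, eval_ofNat, pow_zero, Polynomial.Chebyshev.C_one, eval_X]
    ring
  | succ m ih =>
    rw [Finset.sum_range_succ, mul_add, ih]
    have h := congrArg (Polynomial.eval x) (Polynomial.Chebyshev.C_add_two A (m : ℤ))
    simp only [eval_sub, eval_mul, eval_X] at h
    push_cast
    rw [show (m : ℤ) + 1 + 1 = (m : ℤ) + 2 by ring, h]
    ring

/-- **`(1 − 2xt + t²)·Σ_{k≤n} U_k(x)t^k = 1 − U_{n+1}(x)t^{n+1} + U_n(x)t^{n+2}`** (`x, t` in any commutative ring). [Rivlin 1974, (1.105); DLMF 18.12.10; this file, §1305] -/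
theorem chebyshevU_genFun_trunc {A : Type*} [CommRing A] (x t : A) (n : ℕ) :
    (1 - 2 * x * t + t ^ 2) * ∑ k ∈ Finset.range (n + 1), (Polynomial.Chebyshev.U A (k : ℤ)).eval x * t ^ k =
      1 - (Polynomial.Chebyshev.U A ((n : ℤ) + 1)).eval x * t ^ (n + 1) + (Polynomial.Chebyshev.U A (n : ℤ)).eval x * t ^ (n + 2) := by
  induction n with
  | zero =>
    simp only [zero_add, Finset.sum_range_one, Nat.cast_zero, Polynomial.Chebyshev.U_zero, eval_one, pow_zero, Polynomial.Chebyshev.U_one, eval_mul, eval_ofNat, eval_X]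
    ring
  | succ m ih =>
    rw [Finset.sum_range_succ, mul_add, ih]
    have h := congrArg (Polynomial.eval x) (Polynomial.Chebyshev.U_add_two A (m : ℤ))
    simp only [eval_sub, eval_mul, eval_ofNat, eval_X] at h
    push_cast
    rw [show (m : ℤ) + 1 + 1 = (m : ℤ) + 2 by ring, h]
    ring

/-- **`(1 − 2xt + t²)·Σ_{k≤n} T_k(x)t^k = 1 − xt − T_{n+1}(x)t^{n+1} + T_n(x)t^{n+2}`** (`x, t` in any commutative ring). [Rivlin 1974, (1.104); DLMF 18.12.8; this file, §1305] -/
theorem chebyshevT_genFun_trunc {A : Type*} [CommRing A] (x t : A) (n : ℕ) :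
    (1 - 2 * x * t + t ^ 2) * ∑ k ∈ Finset.range (n + 1), (Polynomial.Chebyshev.T A (k : ℤ)).eval x * t ^ k =
      1 - x * t - (Polynomial.Chebyshev.T A ((n : ℤ) + 1)).eval x * t ^ (n + 1) + (Polynomial.Chebyshev.T A (n : ℤ)).eval x * t ^ (n + 2) := by
  induction n with
  | zero =>
    simp only [zero_add, Finset.sum_range_one, Nat.cast_zero, Polynomial.Chebyshev.T_zero, eval_one, pow_zero, Polynomial.Chebyshev.T_one, eval_X]
    ring
  | succ m ih =>
    rw [Finset.sum_range_succ, mul_add, ih]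
    have h := congrArg (Polynomial.eval x) (Polynomial.Chebyshev.T_add_two A (m : ℤ))
    simp only [eval_sub, eval_mul, eval_ofNat, eval_X] at h
    push_cast
    rw [show (m : ℤ) + 1 + 1 = (m : ℤ) + 2 by ring, h]
    ring

end Summit.Ventures.HSemireg.Wedge.HankelOuter
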